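import Summits.BirchSwinnertonDyer.BirchSwinnertonDyer.Theorems.GenusKolyvaginAtTwoVisiblePairAtTwoClaimsOfK
import Summits.BirchSwinnertonDyer.BirchSwinnertonDyer.Theorems.GenusKolyvaginAtTwoVisiblePairAtTwoClassesOfHeegner
import HarnessLib

/-!
# Route `GenusKolyvaginAtTwo`, LINE 6, KEY crux Q3 (inner statement of stmt-BirchSwinnertonDyer-22137):
# Kolyvagin's Claims A/B over `ℚ` at `2` FOR THE CRUX'S HEEGNER DATA — the pair instance fed with the concrete classes
# `c_M(m)` and their descents; displayed: Q2 over `K`, Lemma 4.3 over `K`, (H2), DEF-freeness, and the Heegner class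
# `c_M(1) = 2^{M₀}·res x` in Kummer currency

Helper (seat `bsd-line-gk2-p3` g13; `--supports` the crux, closes nothing). Composition of this lineage's two assemblies:
`…ClaimsOfK.exists_input_of_K` (the record `Input` from the `K`-statement + DEF-freeness, abstract classes) and
`…ClassesOfHeegner.exists_descent_of_heegnerData_of_rootNumber_eq_neg_one` (the descended classes `c₁`, `c₂` of Kolyvagin's
`c_M(m) = d_m.kolyvaginClass 2 M` for a family `dat` of Kolyvagin–Heegner data on `KolSupp (kolPrime W K M)`, for the member
`E` with `w(E) = −1`). With `cK m := c_M(m)` (`dite` on `KolSupp`):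

* `selmer_mem_of_resTorsion_mem_of_heegner` — **`x ∈ Sel^{(2^M)}(E/ℚ)` from `res x ∈ Sel^{(2^M)}(E/K)`** on the DEF-free
  Heegner habitat (this lineage's place-by-place transfers, `mem_selmerLocalKer_of_K_of_heegner`; `∞` free on `Δ < 0`);
* `pow_zsmul_selmer_eq_zero_and_selmer_le_of_heegnerData` — **Claims A and B over `ℚ` at `2` for the Heegner data**:
  `2^{M₀}·Sel^{(2^M)}(E^{(d_K)}/ℚ) = 0` and `2^{2M₀}·Sel^{(2^M)}(E/ℚ) ⊆ ℤx`, given: the habitat (`E` globally minimal non-CM,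
  `Δ < 0`, `ρ_{E,2^n}` onto ∀ `n`, `w(E) = −1`; `K = ℚ(θ)` imaginary quadratic, `θ² = d_K` odd `≠ −3`, `d_K·(−|Δ|)` non-square,
  Heegner hypothesis; `M ≥ 1`), a frame `(Dt, β, ι)` with data `dat`, a class `x ∈ H¹(ℚ, E[2^M])` with `res x` Selmer over `K`,
  `2^{M−1} x ≠ 0` and **`2^{M₀}·res x = c_M(1)`** (Kolyvagin's `M₀` in Kummer currency), the **Kolyvagin relation over `K`**
  for the `c_M(m)` (Q2 `KolyvaginRelationAtTwo`, currency `kolPrime`), **McCallum's Lemma 4.3 over `K`** for the `c_M(m)`,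
  **(H2)** and **DEF-freeness** `∀ v ∣ d_K, #E(ℚ_v)[2] = 1`;
* `selmer_twin_eq_bot_and_selmer_eq_of_heegnerData_of_primitive` — `M₀ = 0` (`res x = c_M(1)`): `Sel^{(2^M)}(E^{(d_K)}/ℚ) = 0`,
  `Sel^{(2^M)}(E/ℚ) = ℤx`.

What is NOT claimed: the link from the crux's `M₀` (divisibility of `P(1)` in `E(K[1])`) to the Kummer currency, Q2, Lemma 4.3
over `K`, (H2), the Cassels–Tate inputs of exactness — all displayed. THEOREMS ONLY (no definition, no named fact, no `sorry`,
standard axioms). BSD is not proved by any of this.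

References: [Kolyvagin1989Izv] §3 (Thm. `B_l` at `l = 2`); [McCallumLMS1991] §1 Theorem, §4 Lemma 4.3, Prop. 4.4, §5;
[GrossLMS1991] §3–§5, §10.
-/

set_option autoImplicit false
set_option linter.dupNamespace false -- tree convention: `Summit.BirchSwinnertonDyer.BirchSwinnertonDyer.Theorems` (summit = sub-problem)

noncomputable section

open scoped Classical

namespace Summit.BirchSwinnertonDyer.BirchSwinnertonDyer.Theorems.GenusExact.VisiblePairAtTwo

open WeierstrassCurve NumberField IsDedekindDomain Field Rat.HeightOneSpectrum
open Literature.NumberTheory.EllipticCurves Literature.NumberTheory.GaloisRepresentations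
open Literature.NumberTheory.EllipticCurves.KolyvaginDescent Literature.NumberTheory.EllipticCurves.ModularForms
open Summit.BirchSwinnertonDyer.BirchSwinnertonDyer.Theorems.GenusExact.EigenClassesFinite
open Summit.BirchSwinnertonDyer.BirchSwinnertonDyer.Theorems.GenusExact.ArchVanishing

variable (W : WeierstrassCurve ℚ) [W.IsElliptic] [W.IsGloballyMinimal] [NeZero (W.conductorNorm ℤ)]
  (K : Type) [Field K] [NumberField K] (M : ℕ) {θ : K} (hθ : θ ∉ Set.range (algebraMap ℚ K))
  (hθsq : θ ^ 2 = algebraMap ℚ K ((NumberField.discr K : ℤ) : ℚ))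

omit [W.IsGloballyMinimal] [NeZero (W.conductorNorm ℤ)] in
/-- **`x ∈ Sel^{(n)}(E/ℚ)` from `res x ∈ Sel^{(n)}(E/K)` on the DEF-free Heegner habitat** (`K = ℚ(θ)` quadratic, `θ² = d_K`
odd, every `p ∣ N_E` split in `K`, `Δ(E) < 0`, `#E(ℚ_v)[2] = 1` at `v ∣ d_K`): finite places by
`mem_selmerLocalKer_of_K_of_heegner`, infinite places free. [cite: McCallumLMS1991, §4 Lemma 4.3] [cite: MilneADT2006, I Rem. 3.7] -/
theorem selmer_mem_of_resTorsion_mem_of_heegner (hθ : θ ∉ Set.range (algebraMap ℚ K))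
    (hθsq : θ ^ 2 = algebraMap ℚ K ((NumberField.discr K : ℤ) : ℚ))
    (hK : IsImaginaryQuadratic K) (hodd : Odd (NumberField.discr K))
    (hH : SatisfiesHeegnerHypothesis (W.conductorNorm ℤ) K) (hΔ : W.Δ < 0) (n : ℤ) {x : galH1Torsion W n}
    (hxK : resTorsion W K n x ∈ selmerGroup (W.baseChange K) n)
    (htors : ∀ v : HeightOneSpectrum (𝓞 ℚ), ((NumberField.discr K : ℤ) : 𝓞 ℚ) ∈ v.asIdeal →
      Nat.card (nsmulAddMonoidHom 2 : (W.baseChange (v.adicCompletion ℚ)).toAffine.Point →+ _).ker = 1) :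
    x ∈ selmerGroup W n := by
  rw [mem_selmerGroup_iff]
  rw [mem_selmerGroup_iff] at hxK
  exact ⟨fun v ↦ mem_selmerLocalKer_of_K_of_heegner W hK.1 (not_mem_range hθ) hθsq hodd hH n rfl v (htors v)
      (fun w _ ↦ hxK.1 w),
    fun w ↦ mem_selmerLocalKer_infinitePlace_of_Δ_neg W w hΔ n x⟩

/-- **Kolyvagin's Claims A and B over `ℚ` at `2` for the crux's Heegner data.** See the module docstring for the list of
displayed inputs; `cK m := c_M(m) = (dat m _).kolyvaginClass 2 M` (zero off `KolSupp`). Conclusion: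
`2^{M₀}·Sel^{(2^M)}(E^{(d_K)}/ℚ) = 0` and `2^{2M₀}·Sel^{(2^M)}(E/ℚ) ⊆ ℤx`. Nothing about BSD is proved here.
[cite: Kolyvagin1989Izv, §3 (Thm. B_l, l = 2)] [cite: McCallumLMS1991, §1 Theorem and §5] [cite: GrossLMS1991, §5 Prop. 5.4] -/
theorem pow_zsmul_selmer_eq_zero_and_selmer_le_of_heegnerData [(twin W K).IsElliptic] (hcm : ¬ W.HasCM)
    (hΔ : W.Δ < 0) (hK : IsImaginaryQuadratic K) (hodd : Odd (NumberField.discr K)) (hD3 : NumberField.discr K ≠ -3)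
    (hns : ¬ IsSquare ((NumberField.discr K : ℚ) * -|W.Δ|)) (hρ : ∀ n : ℕ, W.HasSurjectiveModNGaloisRep (2 ^ n : ℕ))
    (hH : SatisfiesHeegnerHypothesis (W.conductorNorm ℤ) K) (hw : W.rootNumber = -1) (hM : 1 ≤ M)
    (Dt : ModularParametrizationData W (W.conductorNorm ℤ)) (β : ℤ) (ι : K →+* ℂ)
    (dat : ∀ m : ℕ, KolSupp (kolPrime W K M) m → KolyvaginHeegnerData Dt β ι m)
    (x : galH1Torsion W (lvl M)) (hxK : resTorsion W K (lvl M) x ∈ selmerGroup (W.baseChange K) (lvl M))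
    (x_ord : ((2 : ℤ) ^ (M - 1)) • x ≠ 0) (M₀ : ℕ)
    (hc1 : ((2 : ℤ) ^ M₀) • resTorsion W K (lvl M) x = (dat 1 (kolSupp_one _)).kolyvaginClass Nat.prime_two M)
    (rel : ∀ ℓ m, kolPrime W K M ℓ → ∀ hℓm : KolSupp (kolPrime W K M) (ℓ * m), ∀ hm : KolSupp (kolPrime W K M) m,
      ∀ w : HeightOneSpectrum (𝓞 K), (ℓ : 𝓞 K) ∈ w.asIdeal → ∀ a : ℕ,
        ((2 : ℤ) ^ a) • (dat (ℓ * m) hℓm).kolyvaginClass Nat.prime_two M ∈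
            selmerLocalKer (W.baseChange K) (w.adicCompletion K) (lvl M) ↔
          ((2 : ℤ) ^ a) • (dat m hm).kolyvaginClass Nat.prime_two M ∈
            (W.baseChange K).torsionLocalKer (w.adicCompletion K) (lvl M))
    (hK43 : ∀ m (hm : KolSupp (kolPrime W K M) m), ∀ w : HeightOneSpectrum (𝓞 K), (m : 𝓞 K) ∉ w.asIdeal →
      (dat m hm).kolyvaginClass Nat.prime_two M ∈ selmerLocalKer (W.baseChange K) (w.adicCompletion K) (lvl M))
    (sel_visible : ∀ s₁ ∈ selmerGroup W (lvl M), ∀ s₂ ∈ selmerGroup (twin W K) (lvl M),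
      rK₁ W K M s₁ + rK₂ W M hθ hθsq s₂ = 0 → s₁ = 0 ∧ s₂ = 0)
    (htors : ∀ v : HeightOneSpectrum (𝓞 ℚ), ((NumberField.discr K : ℤ) : 𝓞 ℚ) ∈ v.asIdeal →
      Nat.card (nsmulAddMonoidHom 2 : (W.baseChange (v.adicCompletion ℚ)).toAffine.Point →+ _).ker = 1) :
    (∀ s ∈ selmerGroup (twin W K) (lvl M), ((2 : ℤ) ^ M₀) • s = 0) ∧
      ∀ s ∈ selmerGroup W (lvl M), ∃ a : ℤ, ((2 : ℤ) ^ (2 * M₀)) • s = a • x := by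
  have h2 := hK.1
  have hs : W.HasSurjectiveModNGaloisRep 2 := by simpa using hρ 1
  -- the Kolyvagin classes and their descents
  set cK : ℕ → galH1Torsion (W.baseChange K) (lvl M) := fun m ↦
    if h : KolSupp (kolPrime W K M) m then (dat m h).kolyvaginClass Nat.prime_two M else 0 with hcK
  obtain ⟨c₁, c₂, hres₁, hres₂⟩ :=
    exists_descent_of_heegnerData_of_rootNumber_eq_neg_one W K M hθ hθsq hK hodd hD3 hH hs hM hw Dt β ι dat
  -- `c₁ 1 = 2^{M₀} x` by injectivity of `res`
  have hL := forall_zsmul_two_pow_baseChange_eq_zero_of_hasSurjectiveModNGaloisRep_two W K h2 hs M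
  have hinj := resTorsion_injective_of_noTorsion W K h2 hθ hθsq (lvl M) hL
  have c_one : c₁ 1 = ((2 : ℤ) ^ M₀) • x := by
    apply hinj
    have h1 := hres₁ 1 (kolSupp_one _) (by rw [Nat.primeFactors_one, Finset.card_empty]; exact ⟨0, rfl⟩)
    rw [dif_pos (kolSupp_one _)] at h1
    rw [h1, map_zsmul, hc1]
  -- the `K`-level hypotheses read on `cK`
  have rel' : ∀ ℓ m, kolPrime W K M ℓ → KolSupp (kolPrime W K M) (ℓ * m) →
      ∀ w : HeightOneSpectrum (𝓞 K), (ℓ : 𝓞 K) ∈ w.asIdeal → ∀ a : ℕ,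
        ((2 : ℤ) ^ a) • cK (ℓ * m) ∈ selmerLocalKer (W.baseChange K) (w.adicCompletion K) (lvl M) ↔
          ((2 : ℤ) ^ a) • cK m ∈ (W.baseChange K).torsionLocalKer (w.adicCompletion K) (lvl M) := by
    intro ℓ m hℓ hℓm w hw a
    have hm : KolSupp (kolPrime W K M) m :=
      ⟨hℓm.1.squarefree_of_dvd (dvd_mul_left m ℓ),
        fun q hq ↦ hℓm.2 q (Nat.primeFactors_mono (dvd_mul_left m ℓ) hℓm.1.ne_zero hq)⟩
    simp only [hcK, dif_pos hℓm, dif_pos hm]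
    exact rel ℓ m hℓ hℓm hm w hw a
  have hK43' : ∀ m, KolSupp (kolPrime W K M) m → ∀ w : HeightOneSpectrum (𝓞 K), (m : 𝓞 K) ∉ w.asIdeal →
      cK m ∈ selmerLocalKer (W.baseChange K) (w.adicCompletion K) (lvl M) := by
    intro m hm w hw
    simp only [hcK, dif_pos hm]
    exact hK43 m hm w hw
  exact pow_zsmul_selmer_eq_zero_and_selmer_le_of_K W K M hθ hθsq hcm hΔ hK hodd hns hρ hH hM x
    (selmer_mem_of_resTorsion_mem_of_heegner W K hθ hθsq hK hodd hH hΔ (lvl M) hxK htors) x_ord M₀ c₁ c₂ cK c_one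
    hres₁ hres₂ rel' hK43' sel_visible htors

/-- **`M₀ = 0` for the Heegner data**: if `res x = c_M(1)` (the Heegner class is `2`-primitive at level `2^M`) then
`Sel^{(2^M)}(E^{(d_K)}/ℚ) = 0` and `Sel^{(2^M)}(E/ℚ) = ℤx`, from the same displayed inputs. [cite: Kolyvagin1989Izv, §3]
[cite: GrossLMS1991, §10] -/
theorem selmer_twin_eq_bot_and_selmer_eq_of_heegnerData_of_primitive [(twin W K).IsElliptic] (hcm : ¬ W.HasCM)
    (hΔ : W.Δ < 0) (hK : IsImaginaryQuadratic K) (hodd : Odd (NumberField.discr K)) (hD3 : NumberField.discr K ≠ -3)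
    (hns : ¬ IsSquare ((NumberField.discr K : ℚ) * -|W.Δ|)) (hρ : ∀ n : ℕ, W.HasSurjectiveModNGaloisRep (2 ^ n : ℕ))
    (hH : SatisfiesHeegnerHypothesis (W.conductorNorm ℤ) K) (hw : W.rootNumber = -1) (hM : 1 ≤ M)
    (Dt : ModularParametrizationData W (W.conductorNorm ℤ)) (β : ℤ) (ι : K →+* ℂ)
    (dat : ∀ m : ℕ, KolSupp (kolPrime W K M) m → KolyvaginHeegnerData Dt β ι m)
    (x : galH1Torsion W (lvl M)) (hxK : resTorsion W K (lvl M) x ∈ selmerGroup (W.baseChange K) (lvl M))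
    (x_ord : ((2 : ℤ) ^ (M - 1)) • x ≠ 0)
    (hc1 : resTorsion W K (lvl M) x = (dat 1 (kolSupp_one _)).kolyvaginClass Nat.prime_two M)
    (rel : ∀ ℓ m, kolPrime W K M ℓ → ∀ hℓm : KolSupp (kolPrime W K M) (ℓ * m), ∀ hm : KolSupp (kolPrime W K M) m,
      ∀ w : HeightOneSpectrum (𝓞 K), (ℓ : 𝓞 K) ∈ w.asIdeal → ∀ a : ℕ,
        ((2 : ℤ) ^ a) • (dat (ℓ * m) hℓm).kolyvaginClass Nat.prime_two M ∈
            selmerLocalKer (W.baseChange K) (w.adicCompletion K) (lvl M) ↔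
          ((2 : ℤ) ^ a) • (dat m hm).kolyvaginClass Nat.prime_two M ∈
            (W.baseChange K).torsionLocalKer (w.adicCompletion K) (lvl M))
    (hK43 : ∀ m (hm : KolSupp (kolPrime W K M) m), ∀ w : HeightOneSpectrum (𝓞 K), (m : 𝓞 K) ∉ w.asIdeal →
      (dat m hm).kolyvaginClass Nat.prime_two M ∈ selmerLocalKer (W.baseChange K) (w.adicCompletion K) (lvl M))
    (sel_visible : ∀ s₁ ∈ selmerGroup W (lvl M), ∀ s₂ ∈ selmerGroup (twin W K) (lvl M),
      rK₁ W K M s₁ + rK₂ W M hθ hθsq s₂ = 0 → s₁ = 0 ∧ s₂ = 0)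
    (htors : ∀ v : HeightOneSpectrum (𝓞 ℚ), ((NumberField.discr K : ℤ) : 𝓞 ℚ) ∈ v.asIdeal →
      Nat.card (nsmulAddMonoidHom 2 : (W.baseChange (v.adicCompletion ℚ)).toAffine.Point →+ _).ker = 1) :
    selmerGroup (twin W K) (lvl M) = ⊥ ∧ selmerGroup W (lvl M) = AddSubgroup.zmultiples x := by
  have h := pow_zsmul_selmer_eq_zero_and_selmer_le_of_heegnerData W K M hθ hθsq hcm hΔ hK hodd hD3 hns hρ hH hw hM
    Dt β ι dat x hxK x_ord 0 (by rw [pow_zero, one_smul]; exact hc1) rel hK43 sel_visible htors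
  simp only [mul_zero, pow_zero, one_smul] at h
  obtain ⟨hA, hB⟩ := h
  refine ⟨(AddSubgroup.eq_bot_iff_forall _).mpr fun s hs ↦ hA s hs, ?_⟩
  refine le_antisymm (fun s hs ↦ ?_) ?_
  · obtain ⟨a, ha⟩ := hB s hs
    exact AddSubgroup.mem_zmultiples_iff.mpr ⟨a, ha.symm⟩
  · exact AddSubgroup.zmultiples_le.mpr
      (selmer_mem_of_resTorsion_mem_of_heegner W K hθ hθsq hK hodd hH hΔ (lvl M) hxK htors)

end Summit.BirchSwinnertonDyer.BirchSwinnertonDyer.Theorems.GenusExact.VisiblePairAtTwo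

end
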